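import Mathlib
import Summits.Ventures.PercRepro2.HalfEndpoint

/-!
# `ΓLc` through the endpoint: the `L`-half is the endpoint slack minus the descent `1 → γ`
(blind cell PercRepro2, night-1 g35)

With `E₁ = P(Q,bL)(P(Q,oH) + P(T,o∉U)) − P(Q)(P(Q,bL,oH) + P(T,bL,o∉U))` (`≥ 0` by
`HalfEndpoint.endpoint_one`) and `X = P(Q,bL) P(T) − P(T,bL) P(Q)` (`≥ 0` by `SharpHalves.TbL_mul_Q_le`):

* **`GammaLc_eq_endpoint`**: `ΓLc = 2 [D · E₁ − (D − D_o) · X]` — a linear identity in the pattern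
  masses (`prob_T_inter_Dtilde` splits `{o ∉ U}` on `T`);
* **`endpoint_slack_nonneg`**: `0 ≤ D · E₁`.

So the `L`-half (HALF-L, `0 ≤ ΓLc`) says exactly `D · E₁ ≥ (D − D_o) · X`: the endpoint slack at the
centring `1` dominates `(1 − γ)` times the BHK slack of `(bL, a₃ ∈ H)` — the descent of the centring
from `1` to `γ = D_o/D`.  (Census, night-1 g35: HALF-L and its mirror survive the kit adversary, 0 exact
negatives in 25,600 graphs / 102,400 climbs; the partial descent to `c₀` fails, `SharpHalvesRefutation`.)
-/

namespace Summit.Ventures.PercRepro2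

namespace HalfEndpoint

open UnionCluster CovForm SideBridge

open scoped Classical

variable {V : Type*} {E : Type*} [Fintype E] [DecidableEq E] [Fintype V] [DecidableEq V]
  {R : Type*} [Field R] [LinearOrder R] [IsStrictOrderedRing R]

section Identity

variable (p : E → R) (ends : E → Sym2 V) (o a₁ a₂ a₃ b : V)

omit [Fintype V] [DecidableEq V] in
/-- On `T ⊆ Q` the events `oL`, `oH` are disjoint, so `P(T ∩ X ∩ {o ∉ U}) = P(T ∩ X) − P(T ∩ X ∩ oL) − P(T ∩ X ∩ oH)`
for any event `X`. -/
lemma prob_T_inter_Dtilde (X : Set (Config E)) :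
    prob p (TEvent ends a₁ a₂ a₃ ∩ (X ∩ Dtilde ends a₁ a₂ o)) =
      prob p (TEvent ends a₁ a₂ a₃ ∩ X) -
        prob p (TEvent ends a₁ a₂ a₃ ∩ (connEvent ends a₁ o ∩ X)) -
        prob p (TEvent ends a₁ a₂ a₃ ∩ (connEvent ends a₂ o ∩ X)) := by
  have h := prob_inter_add_prob_inter_compl p (TEvent ends a₁ a₂ a₃ ∩ X)
    (connEvent ends a₁ o ∪ connEvent ends a₂ o)
  have e1 : TEvent ends a₁ a₂ a₃ ∩ X ∩ (connEvent ends a₁ o ∪ connEvent ends a₂ o)ᶜ =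
      TEvent ends a₁ a₂ a₃ ∩ (X ∩ Dtilde ends a₁ a₂ o) := by
    ext ω
    simp only [Set.mem_inter_iff, Set.mem_compl_iff, Set.mem_union, mem_connEvent, Dtilde, inU,
      not_or]
    have h1 : Conn ends ω o a₁ ↔ Conn ends ω a₁ o := ⟨conn_symm, conn_symm⟩
    have h2 : Conn ends ω o a₂ ↔ Conn ends ω a₂ o := ⟨conn_symm, conn_symm⟩
    tauto
  have e2 : TEvent ends a₁ a₂ a₃ ∩ X ∩ (connEvent ends a₁ o ∪ connEvent ends a₂ o) =
      (TEvent ends a₁ a₂ a₃ ∩ (connEvent ends a₁ o ∩ X)) ∪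
        (TEvent ends a₁ a₂ a₃ ∩ (connEvent ends a₂ o ∩ X)) := by
    ext ω
    simp only [Set.mem_inter_iff, Set.mem_union]
    tauto
  have hd : Disjoint (TEvent ends a₁ a₂ a₃ ∩ (connEvent ends a₁ o ∩ X))
      (TEvent ends a₁ a₂ a₃ ∩ (connEvent ends a₂ o ∩ X)) := by
    rw [Set.disjoint_left]
    rintro ω ⟨hT, h1, _⟩ ⟨_, h2, _⟩
    exact hT.1 (conn_trans h2 (conn_symm h1))
  rw [e1, e2, prob_union_of_disjoint p hd] at h
  linarith

omit [Fintype V] in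
/-- **`ΓLc` through the endpoint**: `ΓLc = 2 [D · E₁ − (D − D_o) · X]` with
`E₁ = P(Q,bL)(P(Q,oH) + P(T,o∉U)) − P(Q)(P(Q,bL,oH) + P(T,bL,o∉U))` (`≥ 0`, `endpoint_one`) and
`X = P(Q,bL) P(T) − P(T,bL) P(Q)` (`≥ 0`, `SharpHalves.TbL_mul_Q_le`): the `L`-half is the endpoint
slack minus the descent from the centring `1` to `γ`. -/
theorem GammaLc_eq_endpoint :
    SharpHalves.GammaLc p ends o a₁ a₂ a₃ b =
      2 * (prob p (PDEvent ends a₁ a₂ a₃) *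
            (prob p (avoidAll ends a₂ {a₁} ∩ connEvent ends a₁ b) *
                (prob p (avoidAll ends a₂ {a₁} ∩ connEvent ends a₂ o) +
                  prob p (TEvent ends a₁ a₂ a₃ ∩ Dtilde ends a₁ a₂ o)) -
              prob p (avoidAll ends a₂ {a₁}) *
                (prob p (avoidAll ends a₂ {a₁} ∩ (connEvent ends a₂ o ∩ connEvent ends a₁ b)) +
                  prob p (TEvent ends a₁ a₂ a₃ ∩ (connEvent ends a₁ b ∩ Dtilde ends a₁ a₂ o)))) -
          (prob p (PDEvent ends a₁ a₂ a₃) - Do p ends o a₁ a₂ a₃) *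
            (prob p (avoidAll ends a₂ {a₁} ∩ connEvent ends a₁ b) * prob p (TEvent ends a₁ a₂ a₃) -
              prob p (TEvent ends a₁ a₂ a₃ ∩ connEvent ends a₁ b) *
                prob p (avoidAll ends a₂ {a₁}))) := by
  have hU := prob_T_inter_Dtilde p ends o a₁ a₂ a₃ Set.univ
  simp only [Set.univ_inter, Set.inter_univ] at hU
  have hb := prob_T_inter_Dtilde p ends o a₁ a₂ a₃ (connEvent ends a₁ b)
  rw [hU, hb]
  unfold SharpHalves.GammaLc DEF EQo EQ3 EQ3o Do
  simp only [Qsplit p ends a₁ a₂ a₃, Qsplit_univ p ends a₁ a₂ a₃]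
  ring

/-- **The `L`-half at the centring `1`**: `0 ≤ D · E₁`, the first term of `GammaLc_eq_endpoint`. -/
theorem endpoint_slack_nonneg (hp : IsProbVec p) :
    0 ≤ prob p (PDEvent ends a₁ a₂ a₃) *
      (prob p (avoidAll ends a₂ {a₁} ∩ connEvent ends a₁ b) *
          (prob p (avoidAll ends a₂ {a₁} ∩ connEvent ends a₂ o) +
            prob p (TEvent ends a₁ a₂ a₃ ∩ Dtilde ends a₁ a₂ o)) -
        prob p (avoidAll ends a₂ {a₁}) *
          (prob p (avoidAll ends a₂ {a₁} ∩ (connEvent ends a₂ o ∩ connEvent ends a₁ b)) +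
            prob p (TEvent ends a₁ a₂ a₃ ∩ (connEvent ends a₁ b ∩ Dtilde ends a₁ a₂ o)))) :=
  mul_nonneg (prob_nonneg hp _) (sub_nonneg.mpr (endpoint_one p ends o a₁ a₂ a₃ b hp))

end Identity

end HalfEndpoint

end Summit.Ventures.PercRepro2
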